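import Literature.NumberTheory.ComplexMultiplication.EllipticUnits.KroneckerLimitFormula
import Literature.NumberTheory.QuadraticFields.TwistedDedekindZeta
import Mathlib.NumberTheory.LSeries.DirichletContinuation
import HarnessLib

/-!
# The entire continuation of `L_{K,𝔪}(ε, s)` for a ray-class character `ε = χ ∘ N_{K/ℚ}` of a quadratic field:
# `L_{K,𝔪}(ε, s) = L(s, χ) · L(s, χ·χ_{d_K})` — an `IsRayClassL` WITNESS (Artin factorisation, row A7)

Topic `Literature/NumberTheory/ComplexMultiplication/EllipticUnits` (continuing `KroneckerLimitFormula.lean`, whose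
module docstring lists this as «NOT typed: … the Artin factorisation `L_K(s, χ∘N_{K/ℚ}) = L(s, χ)L(s, χχ_K)` (row A7)»).
Theorems only; NO named fact; NO definition.

For a quadratic field `K` with odd discriminant, a modulus `𝔪`, a homomorphism `ε : Gal(K(𝔪)/K) → ℂˣ` and a
Dirichlet character `χ` modulo `m` such that

* (hε) `ε((𝔟, K(𝔪)/K)) = χ(N𝔟)` for every integral ideal `𝔟` prime to `𝔪` — i.e. `ε = χ ∘ N_{K/ℚ}` as a ray-class
  character (the Artin symbol of `𝔟` acts on the `m`-th roots of unity by `ζ ↦ ζ^{N𝔟}`; THIS identification is the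
  class-field-theoretic input and is an explicit HYPOTHESIS here), and
* (hcop) `χ(N𝔟) = 0` whenever `𝔟` is NOT prime to `𝔪` (the support of `𝔪` lies over the primes dividing `m`),

the `𝔪`-imprimitive series `L_{K,𝔪}(ε, s) = Σ_{(𝔟,𝔪)=1} ε(𝔟)N𝔟^{−s}` (`rayClassLSeries`, a sum over ALL ideals of the
summand extended by zero) IS the twisted Dedekind zeta function `Σ_𝔟 χ(N𝔟)N𝔟^{−s}` (`rayClassLSeries_eq_tsum_twist`),
which the tree factorises for `Re s > 1` as `L(s, χ)·L(s, χχ_{d_K})`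
(`Quadratic.tsum_twist_eq_LSeries_mul_LSeries`, `Literature/NumberTheory/QuadraticFields/TwistedDedekindZeta.lean`);
hence for `χ ≠ 1` and `χχ_{d_K} ≠ 1` the ENTIRE function `s ↦ L(s, χ)·L(s, χχ_{d_K})` (Mathlib's continued
`DirichletCharacter.LFunction`s) is an `IsRayClassL 𝔪 ε` witness (`isRayClassL_of_norm_character`) — the shape
consumed by F5 `kato1551_kroneckerLimitFormula` and by Kato's `lim_{s→0} s⁻¹L_{K,𝔣}(χ, s)`.

Use (cell bsd-cm, crux `EllipticUnitValueSevenOfGZK`, input (5) of K1ᵘ, seat bsd-cm-k-ty1 g25; pen D930 successor menu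
«(A7) Artin factorisation»): with this file the typing debt A7 of the unit-side identity's print column is REDUCED TO the
identification (hε) alone (for `K = ℚ(√−7)`, `𝔪 = 7^{n+1}𝔣`, `χ` of conductor `7^{n+1}|D|`, (hcop) is the route's
LEMMA C bookkeeping).  HONEST LABEL: conditional theorem; nothing here concerns BSD.

## References
J. Neukirch, *Algebraic Number Theory* (1999), Ch. VII §10 (10.4) Proposition (iv) (p. 522), (10.5) Corollary (p. 524),
(10.6) [NeukirchANT1999]; K. Kato, Astérisque 295 (2004) §15.5 (15.5.1) (p. 253) [Kato2004Asterisque];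
A. Baker, *Transcendental Number Theory* (1975) Ch. 5 §2 (1) [Baker1975].
-/

noncomputable section

open scoped NumberField
open Literature.NumberTheory.NumberFields (rayClassField)
open Literature.NumberTheory.QuadraticFields (jacobiChar)
open Literature.NumberTheory.QuadraticFields.Quadratic (tsum_twist_eq_LSeries_mul_LSeries
  changeLevel_mul_changeLevel_natCast)

namespace Literature.NumberTheory.ComplexMultiplication.EllipticUnits

variable {K : Type} [Field K] [NumberField K]

/-- **`L_{K,𝔪}(ε, s) = Σ_𝔟 χ(N𝔟)N𝔟^{−s}`** (all `s`, as `tsum`s over all ideals) when `ε(𝔟) = χ(N𝔟)` on the ideals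
prime to `𝔪` and `χ(N𝔟) = 0` off them. [cite: Kato2004Asterisque, §15.5 (p. 253, "L_{K,𝔣}(χ, s) denotes Σ_𝔟 χ(𝔟)N(𝔟)^{−s} … prime to 𝔣")]
[cite: NeukirchANT1999, Ch. VII §10 (10.4) Proposition (iv) (p. 522)] -/
theorem rayClassLSeries_eq_tsum_twist {𝔪 : Ideal (𝓞 K)}
    (ε : (rayClassField K 𝔪 ≃ₐ[K] rayClassField K 𝔪) →* ℂˣ) {m : ℕ} [NeZero m] (χ : DirichletCharacter ℂ m)
    (hε : ∀ 𝔟 : Ideal (𝓞 K), IsCoprime 𝔟 𝔪 → rayClassCharValue 𝔪 ε 𝔟 = χ (Ideal.absNorm 𝔟))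
    (hcop : ∀ 𝔟 : Ideal (𝓞 K), ¬ IsCoprime 𝔟 𝔪 → χ (Ideal.absNorm 𝔟) = 0) (s : ℂ) :
    rayClassLSeries 𝔪 ε s =
      ∑' 𝔟 : Ideal (𝓞 K), χ (Ideal.absNorm 𝔟) * ((Ideal.absNorm 𝔟 : ℕ) : ℂ) ^ (-s) := by
  unfold rayClassLSeries
  refine tsum_congr fun 𝔟 => ?_
  by_cases h : IsCoprime 𝔟 𝔪
  · rw [rayClassLSeriesTerm_of_isCoprime ε s h, hε 𝔟 h]
  · rw [rayClassLSeriesTerm_of_not_isCoprime ε s h, hcop 𝔟 h, zero_mul]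

/-- **`L_{K,𝔪}(ε, s) = L(s, χ) · L(s, χχ_{d_K})` for `Re s > 1`** (quadratic `K`, odd discriminant; `ε = χ ∘ N` in the sense
of (hε), (hcop)).  The tree's twisted factorisation read on the ray-class series.
[cite: NeukirchANT1999, Ch. VII §10 (10.4) Proposition (iv) (p. 522) and (10.5) Corollary (p. 524)] [cite: Baker1975, Ch. 5 §2 eq. (1)] -/
theorem rayClassLSeries_eq_LSeries_mul_LSeries (h2 : Module.finrank ℚ K = 2) (hodd : Odd (NumberField.discr K))
    {𝔪 : Ideal (𝓞 K)} (ε : (rayClassField K 𝔪 ≃ₐ[K] rayClassField K 𝔪) →* ℂˣ) {m : ℕ} [NeZero m]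
    (χ : DirichletCharacter ℂ m)
    (hε : ∀ 𝔟 : Ideal (𝓞 K), IsCoprime 𝔟 𝔪 → rayClassCharValue 𝔪 ε 𝔟 = χ (Ideal.absNorm 𝔟))
    (hcop : ∀ 𝔟 : Ideal (𝓞 K), ¬ IsCoprime 𝔟 𝔪 → χ (Ideal.absNorm 𝔟) = 0) {s : ℂ} (hs : 1 < s.re) :
    rayClassLSeries 𝔪 ε s =
      LSeries (fun n => χ n) s * LSeries (fun n => χ n * jacobiChar (NumberField.discr K).natAbs n) s := by
  rw [rayClassLSeries_eq_tsum_twist ε χ hε hcop s, tsum_twist_eq_LSeries_mul_LSeries h2 hodd χ hs]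

/-- ★ **THE `IsRayClassL` WITNESS (Artin factorisation, row A7)**: for a quadratic `K` with odd discriminant,
`ε = χ ∘ N_{K/ℚ}` in the sense of (hε)/(hcop) with `χ ≠ 1`, and ANY Dirichlet character `Ψ` (any modulus) with the values
`Ψ(n) = χ(n)χ_{d_K}(n)` and `Ψ ≠ 1`, the entire function `s ↦ L(s, χ)·L(s, Ψ)` (Mathlib's continued `L`-functions)
continues `L_{K,𝔪}(ε, s)`.  (A canonical `Ψ` is the product of the level changes of `χ` and `(·/|d_K|)` to modulus
`m·|d_K|`: `isRayClassL_of_norm_character'`.)  Conditional theorem; (hε) is NOT proved here.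
[cite: NeukirchANT1999, Ch. VII §10 (10.4) Proposition (iv) (p. 522), (10.5) Corollary (p. 524)] [cite: Kato2004Asterisque, §15.5 (15.5.1) (p. 253)] -/
theorem isRayClassL_of_norm_character (h2 : Module.finrank ℚ K = 2) (hodd : Odd (NumberField.discr K))
    {𝔪 : Ideal (𝓞 K)} (ε : (rayClassField K 𝔪 ≃ₐ[K] rayClassField K 𝔪) →* ℂˣ) {m : ℕ} [NeZero m]
    (χ : DirichletCharacter ℂ m) (hχ : χ ≠ 1)
    (hε : ∀ 𝔟 : Ideal (𝓞 K), IsCoprime 𝔟 𝔪 → rayClassCharValue 𝔪 ε 𝔟 = χ (Ideal.absNorm 𝔟))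
    (hcop : ∀ 𝔟 : Ideal (𝓞 K), ¬ IsCoprime 𝔟 𝔪 → χ (Ideal.absNorm 𝔟) = 0)
    {M : ℕ} [NeZero M] (Ψ : DirichletCharacter ℂ M)
    (hΨ : ∀ n : ℕ, Ψ n = χ n * jacobiChar (NumberField.discr K).natAbs n) (hΨ1 : Ψ ≠ 1) :
    IsRayClassL 𝔪 ε (fun s => χ.LFunction s * Ψ.LFunction s) := by
  refine ⟨(DirichletCharacter.differentiable_LFunction hχ).mul (DirichletCharacter.differentiable_LFunction hΨ1),
    fun s hs => ?_⟩
  dsimp only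
  rw [rayClassLSeries_eq_LSeries_mul_LSeries h2 hodd ε χ hε hcop hs, DirichletCharacter.LFunction_eq_LSeries χ hs,
    DirichletCharacter.LFunction_eq_LSeries Ψ hs]
  congr 1
  exact LSeries_congr (fun {n} _ => hΨ n) s

/-- The canonical product character `χ·(·/|d_K|)` modulo `m·|d_K|` has the values `χ(n)χ_{d_K}(n)`.
[cite: NeukirchANT1999, Ch. VII §10 (10.5) Corollary (p. 524)] -/
theorem changeLevel_mul_jacobiChar_natCast {m : ℕ} [NeZero m] (χ : DirichletCharacter ℂ m) (n : ℕ) :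
    (DirichletCharacter.changeLevel (dvd_mul_right m (NumberField.discr K).natAbs) χ *
        DirichletCharacter.changeLevel (dvd_mul_left (NumberField.discr K).natAbs m)
          (jacobiChar (NumberField.discr K).natAbs)) (n : ZMod (m * (NumberField.discr K).natAbs)) =
      χ n * jacobiChar (NumberField.discr K).natAbs n :=
  changeLevel_mul_changeLevel_natCast χ (jacobiChar (NumberField.discr K).natAbs) n

/-- ★′ **The witness with the canonical second character** `Ψ = χ·(·/|d_K|) (mod m·|d_K|)`:
`IsRayClassL 𝔪 ε (s ↦ L(s, χ)·L(s, Ψ))` under (hε), (hcop), `χ ≠ 1`, `Ψ ≠ 1`.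
[cite: NeukirchANT1999, Ch. VII §10 (10.4) Proposition (iv) (p. 522), (10.5) Corollary (p. 524)] -/
theorem isRayClassL_of_norm_character' (h2 : Module.finrank ℚ K = 2) (hodd : Odd (NumberField.discr K))
    {𝔪 : Ideal (𝓞 K)} (ε : (rayClassField K 𝔪 ≃ₐ[K] rayClassField K 𝔪) →* ℂˣ) {m : ℕ} [NeZero m]
    (χ : DirichletCharacter ℂ m) (hχ : χ ≠ 1)
    (hε : ∀ 𝔟 : Ideal (𝓞 K), IsCoprime 𝔟 𝔪 → rayClassCharValue 𝔪 ε 𝔟 = χ (Ideal.absNorm 𝔟))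
    (hcop : ∀ 𝔟 : Ideal (𝓞 K), ¬ IsCoprime 𝔟 𝔪 → χ (Ideal.absNorm 𝔟) = 0)
    [NeZero (m * (NumberField.discr K).natAbs)]
    (hΨ1 : DirichletCharacter.changeLevel (dvd_mul_right m (NumberField.discr K).natAbs) χ *
        DirichletCharacter.changeLevel (dvd_mul_left (NumberField.discr K).natAbs m)
          (jacobiChar (NumberField.discr K).natAbs) ≠ 1) :
    IsRayClassL 𝔪 ε (fun s => χ.LFunction s *
      (DirichletCharacter.changeLevel (dvd_mul_right m (NumberField.discr K).natAbs) χ *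
        DirichletCharacter.changeLevel (dvd_mul_left (NumberField.discr K).natAbs m)
          (jacobiChar (NumberField.discr K).natAbs)).LFunction s) :=
  isRayClassL_of_norm_character h2 hodd ε χ hχ hε hcop _ (changeLevel_mul_jacobiChar_natCast χ) hΨ1

end Literature.NumberTheory.ComplexMultiplication.EllipticUnits

end
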